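import Summits.ResolutionOfSingularities.ResolutionOfSingularities.Theorems.Globalisation.Negative.StubCaSheafConductor
import Summits.ResolutionOfSingularities.ResolutionOfSingularities.Theorems.Globalisation.Negative.StubCaSheafCuspCylinder
import Mathlib.RingTheory.Localization.Basic
import Mathlib.RingTheory.Localization.Ideal
import Mathlib.RingTheory.Localization.Integral
import Mathlib.RingTheory.Localization.Submodule
import Mathlib.RingTheory.Localization.FractionRing
import Mathlib.RingTheory.PrincipalIdealDomain
import Mathlib.Algebra.Polynomial.FieldDivision
import HarnessLib

/-!
# The local cusp `T = R_(x,y)` and `x/1 ∈ ca(T)` (supporting lemma for `StubCaSheafFalse`)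

Negative-lemma chain for crux `Globalisation` (stmt-ResolutionOfSingularities-16486), file 3/6.
`T = U⁻¹R` is the cusp over `k(z)`; `T̄ = (ι₀U)⁻¹ k(z)[t]` (a localisation of the PID `k(z)[t]`,
hence a PID and a domain) contains `T` via the injective `j = IsLocalization.map`, and `x = t²`
is a conductor element: `t²·T̄ ⊆ j(T)` (`conductor_x`: clear the `k(z)`-denominators with
`IsLocalization.integerNormalization` and use `t²·k[z][t] ⊆ k[t²,t³,z]`). Hence
`x/1 ∈ ca²(T) ⊆ ca(T)` by file 1.
-/

set_option linter.dupNamespace false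

-- nested polynomial rings (`k[z][x][y]`) need nested instance synthesis during unification
set_option maxSynthPendingDepth 3

noncomputable section

namespace Summit.ResolutionOfSingularities.ResolutionOfSingularities.Theorems.Globalisation.Negative

open Polynomial Literature.RingTheory.CohomologyAnnihilator

/-! ## The local cusp `T = R_𝔮` inside a PID `T̄` -/

namespace CuspCylinder

open Literature.RingTheory.CohomologyAnnihilator

variable (k : Type) [Field k]

/-- `L = k(z)`. -/
abbrev L := FractionRing (Polynomial k)

/-- `BL = k(z)[t]`. -/
abbrev BL := Polynomial (L k)

/-- `ι₀ : R ↪ k(z)[t]`. -/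
def ι₀ : R k →+* BL k := (mapRingHom (algebraMap (Polynomial k) (L k))).comp (ι k)

/-- Unfolding of `ι₀`. -/
theorem ι₀_apply (r : R k) : ι₀ k r = (ι k r).map (algebraMap (Polynomial k) (L k)) := rfl

/-- `ι₀ : R ↪ k(z)[t]` is injective. -/
theorem ι₀_injective : Function.Injective (ι₀ k) :=
  (map_injective _ (IsFractionRing.injective (Polynomial k) (L k))).comp (ι_injective k)

/-- `k[z][t]` is noetherian (Hilbert). -/
instance : IsNoetherianRing (B k) := Polynomial.isNoetherianRing
/-- `k[z][x][y]` is noetherian (Hilbert). -/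
instance : IsNoetherianRing (P k) := Polynomial.isNoetherianRing
/-- `R` is noetherian (quotient of a noetherian ring). -/
instance : IsNoetherianRing (R k) := inferInstance

/-- `T = U⁻¹R = R_(x,y)`, the local ring of the cusp-cylinder at the generic point of its singular
line: the cusp over `k(z)`. -/
abbrev T := Localization (U k)

/-- `T̄ = (ι₀ U)⁻¹ k(z)[t]`, a PID containing `T` (it contains the normalisation `k(z)[t]_(t)` of `T`). -/
abbrev Tbar := Localization ((U k).map (ι₀ k))

/-- `j : T → T̄`. -/
def j : T k →+* Tbar k := IsLocalization.map (Tbar k) (ι₀ k) (U k).le_comap_map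

/-- `j : T → T̄` is injective (localisation of the injective `ι₀`). -/
theorem j_injective : Function.Injective (j k) :=
  IsLocalization.map_injective_of_injective (U k) (T k) (Tbar k) (ι₀_injective k)

/-- `ι₀(U)` consists of non-zero-divisors of `k(z)[t]`. -/
theorem map_U_le_nonZeroDivisors : (U k).map (ι₀ k) ≤ nonZeroDivisors (BL k) := by
  rintro _ ⟨s, hs, rfl⟩
  apply mem_nonZeroDivisors_of_ne_zero
  intro h
  have hs0 : s = 0 := ι₀_injective k (by rw [h, map_zero])
  rw [hs0] at hs
  exact zero_notMem_U k hs

/-- `T̄` is a domain (localisation of a domain away from `0`). -/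
instance : IsDomain (Tbar k) := IsLocalization.isDomain_localization (map_U_le_nonZeroDivisors k)

/-- A localisation of a principal ideal ring is a principal ideal ring. [folklore] -/
theorem isPrincipalIdealRing_of_isLocalization {A : Type*} [CommRing A] [IsPrincipalIdealRing A]
    (M : Submonoid A) (S : Type*) [CommRing S] [Algebra A S] [IsLocalization M S] :
    IsPrincipalIdealRing S := by
  constructor
  intro J
  obtain ⟨a, ha⟩ := (IsPrincipalIdealRing.principal (J.under A)).principal
  refine ⟨⟨algebraMap A S a, ?_⟩⟩
  rw [← IsLocalization.map_under M (J := J)]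
  change Ideal.map (algebraMap A S) (J.under A) = Ideal.span {algebraMap A S a}
  rw [show J.under A = Ideal.span {a} from ha, Ideal.map_span, Set.image_singleton]

/-- `T̄` is a principal ideal ring (localisation of the PID `k(z)[t]`). -/
instance : IsPrincipalIdealRing (Tbar k) :=
  isPrincipalIdealRing_of_isLocalization ((U k).map (ι₀ k)) (Tbar k)

/-- `ι₀ x = t²`. -/
theorem ι₀_x : ι₀ k (x k) = X ^ 2 := by
  simp [ι₀_apply]

/-- `d ∈ k[z] ∖ 0` as an element of `U`. -/
theorem mk_C_C_mem_U {d : Polynomial k} (hd : d ≠ 0) : Ideal.Quotient.mk _ (C (C d)) ∈ U k := by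
  rw [mem_U_iff, ι_mk, θ_C, expand_C, coeff_C_zero]
  exact hd

/-- CONDUCTOR PROPERTY: `x · T̄ ⊆ j(T)`. -/
theorem conductor_x (b : Tbar k) :
    ∃ a : T k, j k a = j k (algebraMap (R k) (T k) (x k)) * b := by
  obtain ⟨⟨F, S⟩, rfl⟩ := IsLocalization.mk'_surjective ((U k).map (ι₀ k)) b
  obtain ⟨s, hs, hsS⟩ := Submonoid.mem_map.mp S.2
  obtain rfl : S = ⟨ι₀ k s, Submonoid.mem_map_of_mem _ hs⟩ := Subtype.ext hsS.symm
  -- clear the `k(z)`-denominators of `F`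
  obtain ⟨d, hd, hF⟩ :=
    IsLocalization.integerNormalization_spec (nonZeroDivisors (Polynomial k)) (S := L k) F
  set F' : B k := IsLocalization.integerNormalization (nonZeroDivisors (Polynomial k)) F with hF'
  have hd0 : d ≠ 0 := nonZeroDivisors.ne_zero hd
  -- `t² F'` lies in the image of `θ`
  obtain ⟨q, hq⟩ := exists_θ_eq_of_coeff_one k (X ^ 2 * F') (by
    rw [coeff_X_pow_mul']
    simp)
  let r : R k := Ideal.Quotient.mk _ q
  have hr : ι₀ k r = C (algebraMap _ (L k) d) * (X ^ 2 * F) := by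
    change ((ι k) (Ideal.Quotient.mk _ q)).map _ = _
    rw [ι_mk, hq, Polynomial.map_mul, Polynomial.map_pow, map_X, hF, ← algebraMap_smul (L k) d F,
      smul_eq_C_mul]
    ring
  let dR : R k := Ideal.Quotient.mk _ (C (C d))
  have hdR : dR ∈ U k := mk_C_C_mem_U k hd0
  have hιdR : ι₀ k dR = C (algebraMap _ (L k) d) := by
    change ((ι k) (Ideal.Quotient.mk _ (C (C d)))).map _ = _
    rw [ι_mk, θ_C, expand_C, map_C]
  refine ⟨IsLocalization.mk' (T k) r ⟨dR * s, mul_mem hdR hs⟩, ?_⟩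
  rw [j, IsLocalization.map_mk', IsLocalization.map_eq, ι₀_x, IsLocalization.mul_mk'_eq_mk'_of_mul]
  apply IsLocalization.mk'_eq_of_eq
  change ι₀ k (dR * s) * (X ^ 2 * F) = ι₀ k s * ι₀ k r
  rw [map_mul, hr, hιdR]
  ring

/-- `x/1 ∈ ca²(T)`: the conductor element `x = t²` of the cusp `T` over `k(z)` kills all
`Ext^{≥2}_T`. -/
theorem x_mem_cohomologyAnnihilatorOfDegree_two :
    algebraMap (R k) (T k) (x k) ∈ cohomologyAnnihilatorOfDegree (T k) 2 :=
  Conductor.mem_cohomologyAnnihilatorOfDegree_two_of_conductor (j k) (j_injective k) (conductor_x k)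

/-- `x/1 ∈ ca(T)`: the right-hand side of `CaSheaf` at `(R, U)` contains `x/1`. -/
theorem x_mem_cohomologyAnnihilator :
    algebraMap (R k) (T k) (x k) ∈ cohomologyAnnihilator (T k) :=
  cohomologyAnnihilatorOfDegree_le 2 (x_mem_cohomologyAnnihilatorOfDegree_two k)

end CuspCylinder

end Summit.ResolutionOfSingularities.ResolutionOfSingularities.Theorems.Globalisation.Negative

end
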